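import Summits.Ventures.GridStability.Models.StructurePreservingDAEStability
import Literature.MathematicalPhysics.PowerSystems.LosslessMultimachineDichotomy
import HarnessLib

/-!
# GridStability/Models/StructurePreservingDAEResync — near a strict minimum, the machine speeds of the
# DAMPED structure-preserving DAE return to synchronous speed (Barbalat on the energy)

LADDER-GRIDFUSION G3/G2 (model register), seat gridfusion-model-2 (g9); `plan/MODEL-VALIDITY.md` row
**MV-4** (c). Companion of `StructurePreservingDAEStability.lean` (Liapunov stability modulo rotation
of an MV-4 operating point from a positive second variation on the pinned directions). Here the first
DYNAMIC consequence: with a damping torque `Dᵢ(ωᵢ − ω_s)`, `Dᵢ > 0` at every machine (the damped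
record `IsDampedSolution` of `StructurePreservingDAEConservation.lean`; [cite: SauerPai1998, §9.2 eq
(9.18)] transplanted onto (7.194)), every DAE motion with differentiable bus variables and positive
voltages whose pinned initial state is close enough to the operating point has
`ωᵢ(t) → ω_s` for every machine `i`.
MECHANISM: the motion stays in a pinned ball of radius `r` (stability), so `W(t)` is non-increasing
(`dW/dt = −ΣDᵢ(ωᵢ−ω_s)²`, [cite: Padiyar2013, §3.4.4 eq (3.40)]) and bounded below by `W(x*)` (strict
minimum) ⇒ `W(t)` converges; its derivative `−ΣDᵢ(ωᵢ−ω_s)²` is Lipschitz in `t` (speeds, voltages and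
hence accelerations are bounded in the ball) ⇒ Barbalat's lemma
(`Literature.MathematicalPhysics.PowerSystems.tendsto_zero_of_hasDerivAt_of_lipschitz`,
[cite: Leonov2001, Ch. 1 Lemma 1.3]) gives `ΣDᵢ(ωᵢ−ω_s)² → 0`, i.e. `ωᵢ → ω_s`.
THREE COLUMNS: mathematics about MODEL MV-4 (damped variant); no instance, no region size, no rate,
no claim about angles or voltages converging, no sentence about a grid.
-/

noncomputable section

open Finset Real Set Metric Filter
open scoped Topology

namespace Summit.Ventures.GridStability.Models.StructurePreservingDAE.Params

variable {m n : ℕ}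

/-- **Frequency resynchronisation near a pinned strict minimum** (MODEL MV-4, damped variant): `p`
well formed, `(δ*, V*, θ*)` an operating point with `V* > 0`, constant active loads, reactive
characteristics continuous on `(0, ∞)`, `W` strictly larger than at `x*` at every other state of the
slice `{θ_{k₀} = θ*_{k₀}}` within sup-distance `r` (`0 < r < min V*`), all dampings `Dᵢ > 0`. Then
there is `η > 0` such that along every motion of the damped DAE with differentiable bus variables and
positive voltages whose pinned initial state is `η`-close to `x*`, every machine speed tends to the
synchronous speed: `ωᵢ(t) → ω_s`. [cite: Padiyar2013, §3.4.4 eqs (3.32)–(3.40)];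
[cite: Leonov2001, Ch. 1 Lemma 1.3] -/
theorem tendsto_speed_of_strictMin {p : Params m n} (hp : p.WellFormed)
    {δs : Fin m → ℝ} {Vs θs : Fin n → ℝ} (hop : p.IsOperatingPoint δs Vs θs) (hVs : ∀ k, 0 < Vs k)
    (hPL : ∀ k v, p.PL k v = p.PL k (Vs k)) (hQL : ∀ k, ContinuousOn (p.QL k) (Ioi 0))
    (k₀ : Fin n) {r : ℝ} (hr : 0 < r) (hrV : ∀ k, r < Vs k)
    (hmin : ∀ x : PhaseSpace m n, x.2.2.2 k₀ = θs k₀ →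
      dist x ((δs, fun _ => p.ωs, Vs, θs) : PhaseSpace m n) ≤ r →
      x ≠ ((δs, fun _ => p.ωs, Vs, θs) : PhaseSpace m n) →
      p.energy Vs δs (fun _ => p.ωs) Vs θs < p.energy Vs x.1 x.2.1 x.2.2.1 x.2.2.2)
    {D : Fin m → ℝ} (hD : ∀ i, 0 < D i) :
    ∃ η > 0, ∀ (δ ω : ℝ → Fin m → ℝ) (V θ : ℝ → Fin n → ℝ), p.IsDampedSolution D δ ω V θ →
      (∀ k, Differentiable ℝ fun t => V t k) → (∀ k, Differentiable ℝ fun t => θ t k) →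
      (∀ t k, 0 < V t k) →
      dist (pinnedState k₀ (θs k₀) (δ 0) (ω 0) (V 0) (θ 0))
        ((δs, fun _ => p.ωs, Vs, θs) : PhaseSpace m n) < η →
      ∀ i, Tendsto (fun t => ω t i) atTop (𝓝 p.ωs) := by
  -- stability with ε := r keeps the pinned state in the closed r-ball
  obtain ⟨η, hη, hstab⟩ := forall_dist_pinnedState_lt hp hop hVs hPL hQL k₀ hr hrV hmin hr
  refine ⟨η, hη, fun δ ω V θ hsol hVd hθd hVpos h0 i => ?_⟩
  set xs : PhaseSpace m n := (δs, fun _ => p.ωs, Vs, θs) with hxsdef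
  have hclose : ∀ t, 0 ≤ t → dist (pinnedState k₀ (θs k₀) (δ t) (ω t) (V t) (θ t)) xs < r :=
    hstab D δ ω V θ (fun j => (hD j).le) hsol hVd hθd hVpos h0
  -- componentwise bounds along the motion: speeds and voltages
  have hωb : ∀ t, 0 ≤ t → ∀ j, |ω t j - p.ωs| < r := by
    intro t ht j
    have h1 := hclose t ht
    have e1 : dist (ω t j) (xs.2.1 j) ≤ dist (ω t) xs.2.1 := dist_le_pi_dist _ _ j
    have e2 : dist (ω t) xs.2.1 ≤ dist (pinnedState k₀ (θs k₀) (δ t) (ω t) (V t) (θ t)).2 xs.2 := by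
      simpa only [pinnedState, Prod.dist_eq] using
        le_max_left (dist (ω t) xs.2.1) (dist ((V t, fun k => θ t k + (θs k₀ - θ t k₀)) :
          (Fin n → ℝ) × (Fin n → ℝ)) xs.2.2)
    have e3 : dist (pinnedState k₀ (θs k₀) (δ t) (ω t) (V t) (θ t)).2 xs.2
        ≤ dist (pinnedState k₀ (θs k₀) (δ t) (ω t) (V t) (θ t)) xs := by
      simpa only [Prod.dist_eq] using le_max_right
        (dist (pinnedState k₀ (θs k₀) (δ t) (ω t) (V t) (θ t)).1 xs.1)
        (dist (pinnedState k₀ (θs k₀) (δ t) (ω t) (V t) (θ t)).2 xs.2)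
    have : xs.2.1 j = p.ωs := rfl
    rw [← this, ← Real.dist_eq]
    linarith
  have hVb : ∀ t, 0 ≤ t → ∀ k, |V t k - Vs k| < r := by
    intro t ht k
    have h1 := hclose t ht
    have e1 : dist (V t k) (xs.2.2.1 k) ≤ dist (V t) xs.2.2.1 := dist_le_pi_dist _ _ k
    have e2 : dist (V t) xs.2.2.1 ≤ dist (pinnedState k₀ (θs k₀) (δ t) (ω t) (V t) (θ t)).2.2 xs.2.2 := by
      simpa only [pinnedState, Prod.dist_eq] using
        le_max_left (dist (V t) xs.2.2.1) (dist (fun k => θ t k + (θs k₀ - θ t k₀)) xs.2.2.2)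
    have e3 : dist (pinnedState k₀ (θs k₀) (δ t) (ω t) (V t) (θ t)).2.2 xs.2.2
        ≤ dist (pinnedState k₀ (θs k₀) (δ t) (ω t) (V t) (θ t)).2 xs.2 := by
      simpa only [Prod.dist_eq] using le_max_right
        (dist (pinnedState k₀ (θs k₀) (δ t) (ω t) (V t) (θ t)).2.1 xs.2.1)
        (dist (pinnedState k₀ (θs k₀) (δ t) (ω t) (V t) (θ t)).2.2 xs.2.2)
    have e4 : dist (pinnedState k₀ (θs k₀) (δ t) (ω t) (V t) (θ t)).2 xs.2
        ≤ dist (pinnedState k₀ (θs k₀) (δ t) (ω t) (V t) (θ t)) xs := by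
      simpa only [Prod.dist_eq] using le_max_right
        (dist (pinnedState k₀ (θs k₀) (δ t) (ω t) (V t) (θ t)).1 xs.1)
        (dist (pinnedState k₀ (θs k₀) (δ t) (ω t) (V t) (θ t)).2 xs.2)
    have : xs.2.2.1 k = Vs k := rfl
    rw [← this, ← Real.dist_eq]
    linarith
  -- the energy along the motion: derivative −ΣDᵢ(ωᵢ−ω_s)², non-increasing, bounded below by W(x*)
  set E : ℝ → ℝ := fun t => p.energy Vs (δ t) (ω t) (V t) (θ t) with hEdef
  set g : ℝ → ℝ := fun t => -∑ j, D j * (ω t j - p.ωs) ^ 2 with hgdef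
  have hE' : ∀ t, HasDerivAt E (g t) t := fun t =>
    hasDerivAt_energy_damped hp.B_symm hsol hVd hθd hVpos hVs hPL hQL t
  have hEpin : ∀ t, E t = p.energy Vs (pinnedState k₀ (θs k₀) (δ t) (ω t) (V t) (θ t)).1
      (pinnedState k₀ (θs k₀) (δ t) (ω t) (V t) (θ t)).2.1
      (pinnedState k₀ (θs k₀) (δ t) (ω t) (V t) (θ t)).2.2.1
      (pinnedState k₀ (θs k₀) (δ t) (ω t) (V t) (θ t)).2.2.2 := by
    intro t
    simp only [hEdef, pinnedState]
    rw [energy_eq_kinetic_add_potential, energy_eq_kinetic_add_potential,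
      potential_rotate_of_isOperatingPoint hp hop hPL]
  have hElow : ∀ t, 0 ≤ t → p.energy Vs δs (fun _ => p.ωs) Vs θs ≤ E t := by
    intro t ht
    rw [hEpin t]
    set y := pinnedState k₀ (θs k₀) (δ t) (ω t) (V t) (θ t) with hydef
    by_cases hy : y = xs
    · rw [hy]
    · exact (hmin y (by simp [hydef, pinnedState]) (hclose t ht).le hy).le
  have hEanti : AntitoneOn E (Ici 0) := by
    refine antitoneOn_of_deriv_nonpos (convex_Ici 0) (fun t _ => (hE' t).continuousAt.continuousWithinAt)
      (fun t _ => (hE' t).differentiableAt.differentiableWithinAt) fun t _ => ?_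
    rw [(hE' t).deriv, hgdef]
    simp only [neg_nonpos]
    exact Finset.sum_nonneg fun j _ => mul_nonneg (hD j).le (sq_nonneg _)
  -- `E` restricted to `[0, ∞)` converges (antitone, bounded below)
  set F : ℝ → ℝ := fun t => E (max t 0) with hFdef
  have hFanti : Antitone F := fun s t hst =>
    hEanti (mem_Ici.2 (le_max_right s 0)) (mem_Ici.2 (le_max_right t 0)) (max_le_max hst le_rfl)
  have hFbdd : BddBelow (range F) := ⟨p.energy Vs δs (fun _ => p.ωs) Vs θs, by
    rintro _ ⟨t, rfl⟩; exact hElow (max t 0) (le_max_right t 0)⟩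
  have hFlim : Tendsto F atTop (𝓝 (⨅ t, F t)) := tendsto_atTop_ciInf hFanti hFbdd
  have hElim : Tendsto E atTop (𝓝 (⨅ t, F t)) := by
    refine hFlim.congr' ?_
    filter_upwards [eventually_ge_atTop 0] with t ht
    simp [hFdef, max_eq_left ht]
  -- `g` is Lipschitz on `[0, ∞)`: its derivative is bounded there
  have hω' : ∀ t j, HasDerivAt (fun s => ω s j)
      ((p.TM j - p.PG (δ t) (V t) (θ t) j - D j * (ω t j - p.ωs)) / p.M j) t := by
    intro t j
    have hMj : p.M j ≠ 0 := ne_of_gt (div_pos (mul_pos two_pos (hp.H_pos j)) hp.ωs_pos)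
    have hd := (hsol.differentiable_ω j t).hasDerivAt
    have hsw := hsol.swing t j
    have : deriv (fun s => ω s j) t
        = (p.TM j - p.PG (δ t) (V t) (θ t) j - D j * (ω t j - p.ωs)) / p.M j := by
      rw [eq_div_iff hMj, mul_comm]; exact hsw
    rw [← this]; exact hd
  set A : Fin m → ℝ := fun j =>
    (|p.TM j| + |p.E j| * (Vs (p.bus j) + r) / p.Xd' j + D j * r) / p.M j with hAdef
  have hMpos : ∀ j, 0 < p.M j := fun j => div_pos (mul_pos two_pos (hp.H_pos j)) hp.ωs_pos
  have hacc : ∀ t, 0 ≤ t → ∀ j,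
      |(p.TM j - p.PG (δ t) (V t) (θ t) j - D j * (ω t j - p.ωs)) / p.M j| ≤ A j := by
    intro t ht j
    rw [abs_div, abs_of_pos (hMpos j), hAdef]
    refine div_le_div_of_nonneg_right ?_ (hMpos j).le
    have hPG : |p.PG (δ t) (V t) (θ t) j| ≤ |p.E j| * (Vs (p.bus j) + r) / p.Xd' j := by
      unfold PG
      rw [abs_div, abs_of_pos (hp.Xd'_pos j)]
      refine div_le_div_of_nonneg_right ?_ (hp.Xd'_pos j).le
      rw [abs_mul, abs_mul]
      have hV1 : |V t (p.bus j)| ≤ Vs (p.bus j) + r := by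
        have := hVb t ht (p.bus j)
        have hv := hVpos t (p.bus j)
        rw [abs_of_pos hv]
        linarith [(abs_lt.1 this).2]
      calc |p.E j| * |V t (p.bus j)| * |Real.sin (δ t j - θ t (p.bus j))|
          ≤ |p.E j| * (Vs (p.bus j) + r) * 1 :=
            mul_le_mul (mul_le_mul_of_nonneg_left hV1 (abs_nonneg _)) (Real.abs_sin_le_one _)
              (abs_nonneg _) (mul_nonneg (abs_nonneg _) (by linarith [hVs (p.bus j)]))
        _ = |p.E j| * (Vs (p.bus j) + r) := by rw [mul_one]
    have hDω : |D j * (ω t j - p.ωs)| ≤ D j * r := by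
      rw [abs_mul, abs_of_pos (hD j)]
      exact mul_le_mul_of_nonneg_left (hωb t ht j).le (hD j).le
    calc |p.TM j - p.PG (δ t) (V t) (θ t) j - D j * (ω t j - p.ωs)|
        ≤ |p.TM j - p.PG (δ t) (V t) (θ t) j| + |D j * (ω t j - p.ωs)| := abs_sub _ _
      _ ≤ |p.TM j| + |p.PG (δ t) (V t) (θ t) j| + |D j * (ω t j - p.ωs)| := by
          have h := abs_sub (p.TM j) (p.PG (δ t) (V t) (θ t) j)
          linarith
      _ ≤ |p.TM j| + |p.E j| * (Vs (p.bus j) + r) / p.Xd' j + D j * r := by linarith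
  -- derivative of `g` and its bound on `[0, ∞)`
  set acc : ℝ → Fin m → ℝ := fun t j =>
    (p.TM j - p.PG (δ t) (V t) (θ t) j - D j * (ω t j - p.ωs)) / p.M j with haccdef
  set g' : ℝ → ℝ := fun t =>
    -∑ j, D j * (((2 : ℕ) : ℝ) * (ω t j - p.ωs) ^ (2 - 1) * acc t j) with hg'def
  have hg' : ∀ t, HasDerivAt g (g' t) t := by
    intro t
    have hs : HasDerivAt (fun s => ∑ j, D j * (ω s j - p.ωs) ^ 2)
        (∑ j, D j * (((2 : ℕ) : ℝ) * (ω t j - p.ωs) ^ (2 - 1) * acc t j)) t :=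
      HasDerivAt.fun_sum fun j _ => (((hω' t j).sub_const p.ωs).pow 2).const_mul (D j)
    exact hs.fun_neg
  set Lg : ℝ := ∑ j, D j * (2 * r * A j) with hLgdef
  have hg'b : ∀ t, 0 ≤ t → |g' t| ≤ Lg := by
    intro t ht
    rw [hg'def, abs_neg]
    refine (Finset.abs_sum_le_sum_abs _ _).trans (Finset.sum_le_sum fun j _ => ?_)
    rw [abs_mul, abs_of_pos (hD j)]
    refine mul_le_mul_of_nonneg_left ?_ (hD j).le
    push_cast
    simp only [pow_one, abs_mul, show |(2 : ℝ)| = 2 by norm_num]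
    have h1 := (hωb t ht j).le
    have h2 := hacc t ht j
    exact mul_le_mul (mul_le_mul_of_nonneg_left h1 zero_le_two) h2 (abs_nonneg _)
      (mul_nonneg zero_le_two hr.le)
  have hbound : ∀ τ ∈ Ici (0 : ℝ), ‖g' τ‖ ≤ Lg := fun τ hτ => by
    rw [Real.norm_eq_abs]
    exact hg'b τ hτ
  have hLip : ∀ s t, 0 ≤ s → 0 ≤ t → |g t - g s| ≤ Lg * |t - s| := by
    intro s t hs ht
    have h := Convex.norm_image_sub_le_of_norm_hasDerivWithin_le (s := Ici (0 : ℝ))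
      (fun τ _ => (hg' τ).hasDerivWithinAt) hbound (convex_Ici 0) (mem_Ici.2 hs) (mem_Ici.2 ht)
    rw [Real.norm_eq_abs, Real.norm_eq_abs] at h
    exact h
  -- Barbalat: `g → 0`
  have hg0 : Tendsto g atTop (𝓝 0) :=
    Literature.MathematicalPhysics.PowerSystems.tendsto_zero_of_hasDerivAt_of_lipschitz
      (a := 0) (fun t _ => hE' t) hLip hElim
  -- the i-th dissipation term is squeezed to zero
  have hsum0 : Tendsto (fun t => ∑ j, D j * (ω t j - p.ωs) ^ 2) atTop (𝓝 0) := by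
    have hneg := hg0.neg
    simpa [hgdef] using hneg
  have hterm : Tendsto (fun t => D i * (ω t i - p.ωs) ^ 2) atTop (𝓝 0) :=
    squeeze_zero (fun t => mul_nonneg (hD i).le (sq_nonneg _))
      (fun t => Finset.single_le_sum (f := fun j => D j * (ω t j - p.ωs) ^ 2)
        (fun j _ => mul_nonneg (hD j).le (sq_nonneg _)) (Finset.mem_univ i)) hsum0
  have hsq : Tendsto (fun t => (ω t i - p.ωs) ^ 2) atTop (𝓝 0) := by
    have := hterm.div_const (D i)
    rw [zero_div] at this
    refine this.congr fun t => ?_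
    field_simp [(hD i).ne']
  have habs : Tendsto (fun t => |ω t i - p.ωs|) atTop (𝓝 0) := by
    have := (Real.continuous_sqrt.tendsto 0).comp hsq
    rw [Real.sqrt_zero] at this
    refine this.congr fun t => ?_
    simp [Real.sqrt_sq_eq_abs]
  have hdiff : Tendsto (fun t => ω t i - p.ωs) atTop (𝓝 0) :=
    squeeze_zero_norm (fun t => by rw [Real.norm_eq_abs]) habs
  have hfin := hdiff.add_const p.ωs
  simpa using hfin

/-- **Frequency resynchronisation from a positive second variation on the pinned directions** (the two
halves assembled, as `forall_dist_pinnedState_lt_of_hessianQuad_pos`): `p` well formed, operating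
point with `V* > 0`, smooth loads, `hessianQuad` positive on every nonzero direction with `φ_{k₀} = 0`
(what an exact PD certificate of the pinned Hessian delivers on an instance), all dampings `Dᵢ > 0`.
Then there is `η > 0` such that along every motion of the damped DAE with differentiable bus
variables and positive voltages whose pinned initial state is `η`-close to `x*`, every machine speed
tends to the synchronous speed. [cite: Padiyar2013, §3.4.4 eqs (3.32)–(3.40)];
[cite: Leonov2001, Ch. 1 Lemma 1.3] -/
theorem tendsto_speed_of_hessianQuad_pos {p : Params m n} (hp : p.WellFormed)
    {δs : Fin m → ℝ} {Vs θs : Fin n → ℝ} (hop : p.IsOperatingPoint δs Vs θs) (hVs : ∀ k, 0 < Vs k)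
    {QL' : Fin n → ℝ → ℝ} (hL : p.SmoothLoads Vs QL') (k₀ : Fin n)
    (hpos : ∀ (a : Fin m → ℝ) (u φ : Fin n → ℝ), φ k₀ = 0 → (a, u, φ) ≠ 0 →
      0 < p.hessianQuad QL' δs a Vs θs u φ) {D : Fin m → ℝ} (hD : ∀ i, 0 < D i) :
    ∃ η > 0, ∀ (δ ω : ℝ → Fin m → ℝ) (V θ : ℝ → Fin n → ℝ), p.IsDampedSolution D δ ω V θ →
      (∀ k, Differentiable ℝ fun t => V t k) → (∀ k, Differentiable ℝ fun t => θ t k) →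
      (∀ t k, 0 < V t k) →
      dist (pinnedState k₀ (θs k₀) (δ 0) (ω 0) (V 0) (θ 0))
        ((δs, fun _ => p.ωs, Vs, θs) : PhaseSpace m n) < η →
      ∀ i, Tendsto (fun t => ω t i) atTop (𝓝 p.ωs) := by
  obtain ⟨r₁, hr₁, hlt⟩ := energy_lt_of_hessianQuad_pos hp hop hVs hL k₀ hpos
  obtain ⟨v₀, hv₀, hv⟩ : ∃ v₀ > 0, ∀ k, v₀ ≤ Vs k := by
    rcases isEmpty_or_nonempty (Fin n) with h | h
    · exact ⟨1, one_pos, fun k => (IsEmpty.false k).elim⟩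
    · obtain ⟨k₁, -, hk₁⟩ := Finset.exists_min_image Finset.univ Vs Finset.univ_nonempty
      exact ⟨Vs k₁, hVs k₁, fun k => hk₁ k (Finset.mem_univ k)⟩
  set r := min (r₁ / 2) (v₀ / 2) with hrdef
  have hr : 0 < r := lt_min (by linarith) (by linarith)
  have hrV : ∀ k, r < Vs k := fun k => lt_of_le_of_lt (min_le_right _ _) (by linarith [hv k])
  have hrr₁ : r < r₁ := lt_of_le_of_lt (min_le_left _ _) (by linarith)
  refine tendsto_speed_of_strictMin hp hop hVs hL.PL_const hL.QL_continuousOn k₀ hr hrV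
    (fun x hxP hxd hne => ?_) hD
  set xs : PhaseSpace m n := (δs, fun _ => p.ωs, Vs, θs) with hxsdef
  have hφ : (x.2.2.2 - θs) k₀ = 0 := by simp [hxP]
  have hne' : ((x.1 - δs, x.2.1 - fun _ => p.ωs, x.2.2.1 - Vs, x.2.2.2 - θs) : PhaseSpace m n) ≠ 0 := by
    intro h
    obtain ⟨h1, h2, h3, h4⟩ : x.1 - δs = 0 ∧ (x.2.1 - fun _ => p.ωs) = 0 ∧ x.2.2.1 - Vs = 0 ∧
        x.2.2.2 - θs = 0 := by simpa only [Prod.mk_eq_zero] using h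
    apply hne
    rw [hxsdef]
    exact Prod.ext (sub_eq_zero.1 h1) (Prod.ext (sub_eq_zero.1 h2)
      (Prod.ext (sub_eq_zero.1 h3) (sub_eq_zero.1 h4)))
  have hnorm : ‖((x.1 - δs, x.2.1 - fun _ => p.ωs, x.2.2.1 - Vs, x.2.2.2 - θs) : PhaseSpace m n)‖
      < r₁ := by
    have : ((x.1 - δs, x.2.1 - fun _ => p.ωs, x.2.2.1 - Vs, x.2.2.2 - θs) : PhaseSpace m n)
        = x - xs := by
      rw [hxsdef]
      exact Prod.ext (by simp) (Prod.ext (by simp) (Prod.ext (by simp) (by simp)))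
    rw [this, ← dist_eq_norm]
    exact lt_of_le_of_lt hxd hrr₁
  have h := hlt (x.1 - δs) (x.2.1 - fun _ => p.ωs) (x.2.2.1 - Vs) (x.2.2.2 - θs) hφ hne' hnorm
  simpa using h

end Summit.Ventures.GridStability.Models.StructurePreservingDAE.Params

end
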